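/-
Copyright (c) 2026. All rights reserved.
Released under Apache 2.0 license as described in the file LICENSE.
Authors: abc-iut cell, seat abc-iut-w5-d004 (SUBDAG FrdI:Prop4.4(iv), converse directions; the
birationalization `C^birat` and its API are abc-iut-L6-t8's, the `BiratData` instance abc-iut-L6-t6's).
-/
import Literature.AlgebraicGeometry.Frobenioids.BirationalizationBiratData
import Literature.AlgebraicGeometry.Frobenioids.BirationalizationMorphisms
import Literature.AlgebraicGeometry.Frobenioids.BirationalizationIsos
import Literature.AlgebraicGeometry.Frobenioids.EquivalenceUnitsTransport
import HarnessLib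

/-!
# Frobenioids I, Proposition 4.4 (iv), the "ONLY IF" directions: what `C → C^birat` reflects

Mochizuki, *The geometry of Frobenioids I: the general theory*, Kyushu J. Math. **62** (2008)
293–400, §4, Proposition 4.4 (iv), statement kurims p. 83, proof p. 84 l. 47 – p. 85 l. 31
[cite: MochizukiFrdI2008, Prop. 4.4 (iv) p.83]: "A morphism of `C` maps to a(n) … isomorphism;
morphism of Frobenius type; … co-angular morphism … of `C^birat` IF AND ONLY IF it is a(n) …
co-angular pre-step; co-angular base-isomorphism; … co-angular morphism … of `C`. … An object of `C`
maps to an isotropic object of `C^birat` if and only if it is an isotropic object of `C`."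

abc-iut-L1-t3's typed predicate `PreFrobenioidData.Prop44iv` records the IMAGE direction only (disclosed
in its docstring; discharged for every Frobenioid in `BirationalizationProp44General.lean`). This
PROOF-ONLY file (SUB-DAG `FrdI:Prop4.4(iv)`, rows L04/L10–L12; seat abc-iut-w5-d004) proves the printed
CONVERSE directions for EVERY Frobenioid, over abc-iut-L6-t8's `toBirat` / abc-iut-L6-t6's `biratOps`:
* `isIso_of_isIsometricPreStep_of_isCoAngular_comp` — an isometric pre-step `ι` with `c ≫ ι` co-angular
  for a base-isomorphism `c` is an isomorphism (Def. 1.2 (iii) applied to `c ≫ ι ≫ id`); in particular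
  Prop. 1.4 (iii): a co-angular isometric pre-step is an isomorphism (`isIso_of_isCoAngularPreStep_of_isIsometry`);
* **isomorphism ⇒ co-angular pre-step** (`isCoAngularPreStep_of_isIso_toBirat_map`, p. 84 l. 47–48
  "Proposition 1.7, (v)"): if `φ^birat` is invertible, `φ` is a pre-step; writing `φ = β ≫ ι`
  (Def. 1.3 (v)(b)) the inverse `[(a, b)]` of `ι^birat` yields a co-angular pre-step `ε ≫ a = (ε ≫ b) ≫ ι`
  ending in `ι`, so `ι` is an isomorphism;
* **co-angular^birat ⇒ co-angular** (`isCoAngular_of_isCoAngular_toBirat_map`, p. 85 l. 8–14);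
* **Frobenius type^birat ⇒ co-angular base-isomorphism** (`isCoAngular_isBaseIso_of_isFrobeniusType_toBirat_map`);
* **isotropic^birat ⇒ isotropic** (`isIsotropic_of_isIsotropic_toBirat_obj`, p. 85 l. 29–31);
* **pull-back^birat ⇔ co-angular linear** (`isPullbackMorphism_toBirat_map_iff`, p. 85 l. 18–29:
  linearity of `φ` directly from the pull-back property of `φ^birat` and the multiplicativity of
  Frobenius degrees (`isLinear_of_isPullbackMorphism_toBirat_map`; print goes through "`C^birat` is a
  Frobenioid"), `φ = (pre-step) ≫ (pull-back)` by Def. 1.3 (iv)(a) with the Frobenius-type factor an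
  isomorphism [= Prop. 1.7 (iii)], and "`φ^birat = γ^birat ∘ α^birat` with `φ^birat`, `γ^birat`
  pull-back morphisms and `α^birat` a base-isomorphism implies formally that `α^birat` is an
  isomorphism" = `PreFrobenioidData.isIso_of_isPullbackMorphism_comp`).
With `BirationalizationProp44General.lean` this gives [FrdI] Prop. 4.4 (iv) AS PRINTED, all «iff»s,
for EVERY Frobenioid. No new definition; nothing here bears on the disputed IUT claims.
-/

namespace Literature.AlgebraicGeometry.Frobenioids

open CategoryTheory Opposite

namespace PreFrobenioid

universe w v v' u u'

variable {D : Type u} [Category.{v} D] {Φ : Dᵒᵖ ⥤ CommMonCat.{w}}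
  {C : Type u'} [Category.{v'} C] {F : C ⥤ ElemFrobenioid Φ}

/-! ### Prop. 1.4 (iii) and a variant -/

/-- An isometric pre-step `ι : X → Y` such that `c ≫ ι` is co-angular for some base-isomorphism
`c : W → X` is an isomorphism (Def. 1.2 (iii) applied to the factorisation `c ≫ ι ≫ id`).
[cite: MochizukiFrdI2008, Prop. 1.4 (iii) p.25] -/
theorem isIso_of_isIsometricPreStep_of_isCoAngular_comp {W X Y : C} {c : W ⟶ X} {ι : X ⟶ Y}
    (hc : IsBaseIso F c) (hι : IsIsometry F ι ∧ IsPreStep F ι) (hco : IsCoAngular F (c ≫ ι)) :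
    IsIso ι :=
  hco c ι (𝟙 Y) (by rw [Category.comp_id]) (isPreStep_id' F Y).1 hι.1 hι.2 (Or.inr hc)

/-- **Prop. 1.4 (iii)** (the case used on p. 85 l. 11: "a co-angular pre-step, hence an isomorphism
whenever it is an isometry"): a co-angular isometric pre-step is an isomorphism.
[cite: MochizukiFrdI2008, Prop. 1.4 (iii) p.25] -/
theorem isIso_of_isCoAngularPreStep_of_isIsometry {X Y : C} {ι : X ⟶ Y} (hι : IsCoAngularPreStep F ι)
    (hiso : IsIsometry F ι) : IsIso ι :=
  isIso_of_isIsometricPreStep_of_isCoAngular_comp (c := 𝟙 X) (isPreStep_id' F X).2 ⟨hiso, hι.2⟩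
    (by rw [Category.id_comp]; exact hι.1)

namespace Birat

variable {hF : IsFrobenioid F} {hsq : HasBiratSquares F}

/-! ### isomorphism in `C^birat` ⇒ co-angular pre-step in `C` -/

/-- If `φ^birat` is an isomorphism then `φ` is a pre-step of `C` (linear and a base-isomorphism are read
off `C^birat → F_{0_D}`, which agrees with `C → F_Φ` on degrees and base maps).
[cite: MochizukiFrdI2008, Prop. 4.4 (iv) p.84] -/
theorem isPreStep_of_isIso_toBirat_map {A B : C} (φ : A ⟶ B) [IsIso ((toBirat F hF hsq).map φ)] :
    IsPreStep F φ := by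
  have h : (biratOps hF hsq).IsPreStep ((toBirat F hF hsq).map φ) :=
    PreFrobenioid.isPreStep_of_isIso (Birat.toElemZero hF hsq) ((toBirat F hF hsq).map φ)
  refine ⟨?_, ?_⟩
  · have h1 : (biratOps hF hsq).degFr ((toBirat F hF hsq).map φ) = 1 := h.1
    rwa [biratOps_degFr_toBirat] at h1
  · have h2 : IsIso ((biratOps hF hsq).base.map ((toBirat F hF hsq).map φ)) := h.2
    rwa [biratOps_base_map_toBirat] at h2

/-- An ISOMETRIC pre-step `ι` of `C` whose image `ι^birat` is an isomorphism is an isomorphism: the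
inverse is a class `[(a, b)]` (`a` a co-angular pre-step) with `[(a, b)] ≫ ι^birat = id`, i.e.
`(ε ≫ b) ≫ ι = ε ≫ a` for co-angular pre-steps `ε`, `a` — a co-angular morphism ending in `ι` with
`ε ≫ b` a base-isomorphism. [cite: MochizukiFrdI2008, Prop. 4.4 (iv) p.84] -/
theorem isIso_of_isIsometricPreStep_of_isIso_toBirat_map {X Y : C} (ι : X ⟶ Y)
    (hι : IsIsometry F ι ∧ IsPreStep F ι) [IsIso ((toBirat F hF hsq).map ι)] : IsIso ι := by
  obtain ⟨f, hf⟩ : ∃ f : BiratFrac F Y X,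
      (Birat.homMk f : (toBirat F hF hsq).obj Y ⟶ (toBirat F hF hsq).obj X) =
        inv ((toBirat F hF hsq).map ι) :=
    Birat.homMk_surjective _
  -- `[(f.den, f.num)] ≫ ι^birat = id`, computed with the square `(id, f.num)`
  let S : BiratFrac.Square f (BiratFrac.ofHom hF ι) :=
    { apex := f.src, left := 𝟙 _, right := f.num, left_mem := isCoAngularPreStep_id hF _
      w := by
        change 𝟙 _ ≫ f.num = f.num ≫ 𝟙 _
        rw [Category.id_comp, Category.comp_id] }
  have hcomp : (Birat.homMk f ≫ (toBirat F hF hsq).map ι :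
      (toBirat F hF hsq).obj Y ⟶ (toBirat F hF hsq).obj Y) = 𝟙 _ :=
    (congrArg (· ≫ (toBirat F hF hsq).map ι) hf).trans (IsIso.inv_hom_id _)
  have hcomp' : (Birat.homMk (BiratFrac.compWith hF f (BiratFrac.ofHom hF ι) S) :
      (toBirat F hF hsq).obj Y ⟶ (toBirat F hF hsq).obj Y) =
        Birat.homMk (BiratFrac.ofHom hF (𝟙 Y)) :=
    ((Birat.homMk_comp_homMk_eq (X := (toBirat F hF hsq).obj Y) (Y := (toBirat F hF hsq).obj X)
      (Z := (toBirat F hF hsq).obj Y) f (BiratFrac.ofHom hF ι) S).symm.trans hcomp).trans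
      (Birat.id_eq _)
  obtain ⟨E, ε, ε', hε, -, hden, hnum⟩ := Birat.homMk_eq_homMk_iff.mp hcomp'
  -- `hden : ε ≫ (𝟙 ≫ f.den) = ε' ≫ 𝟙`, `hnum : ε ≫ (f.num ≫ ι) = ε' ≫ 𝟙`
  have hden' : ε ≫ f.den = ε' := by
    have h : ε ≫ (𝟙 _ ≫ f.den) = ε' ≫ 𝟙 Y := hden
    exact ((congrArg (ε ≫ ·) (Category.id_comp f.den)).symm.trans h).trans (Category.comp_id ε')
  have hnum' : (ε ≫ f.num) ≫ ι = ε ≫ f.den := by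
    have h : ε ≫ (f.num ≫ ι) = ε' ≫ 𝟙 Y := hnum
    exact (Category.assoc _ _ _).trans ((h.trans (Category.comp_id ε')).trans hden'.symm)
  have hcoa : IsCoAngularPreStep F ((ε ≫ f.num) ≫ ι) :=
    (congrArg (IsCoAngularPreStep F) hnum').mpr (hε.comp hF f.den_mem)
  have hc : IsBaseIso F (ε ≫ f.num) := by
    have hb : IsIso (Base F (ε ≫ f.num) ≫ Base F ι) :=
      (congrArg IsIso (base_comp F (ε ≫ f.num) ι)).mp hcoa.2.2
    exact @IsIso.of_isIso_comp_right _ _ _ _ _ (Base F (ε ≫ f.num)) (Base F ι) hι.2.2 hb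
  exact isIso_of_isIsometricPreStep_of_isCoAngular_comp hc hι hcoa.1

/-- **Prop. 4.4 (iv)**, isomorphisms, ONLY-IF direction ("a morphism of `C` maps to an isomorphism of
`C^birat` if and only if it is a co-angular pre-step", p. 83; p. 84 l. 47–48): if `φ^birat` is an
isomorphism then `φ` is a co-angular pre-step — `φ` is a pre-step, `φ = β ≫ ι` with `β` a co-angular
pre-step and `ι` an isometric pre-step (Def. 1.3 (v)(b)), and `ι^birat = (β^birat)⁻¹ ≫ φ^birat` is an
isomorphism, so `ι` is. [cite: MochizukiFrdI2008, Prop. 4.4 (iv) p.83] -/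
theorem isCoAngularPreStep_of_isIso_toBirat_map {A B : C} (φ : A ⟶ B)
    [IsIso ((toBirat F hF hsq).map φ)] : IsCoAngularPreStep F φ := by
  have hpre : IsPreStep F φ := isPreStep_of_isIso_toBirat_map φ
  obtain ⟨X, β, ι, hβι, hβ, hι⟩ := hF.v_b_exists φ hpre
  haveI := isIso_toBirat_map (hF := hF) (hsq := hsq) β hβ
  haveI : IsIso ((toBirat F hF hsq).map β ≫ (toBirat F hF hsq).map ι) := by
    rw [← Functor.map_comp, hβι]; infer_instance
  haveI : IsIso ((toBirat F hF hsq).map ι) :=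
    IsIso.of_isIso_comp_left ((toBirat F hF hsq).map β) ((toBirat F hF hsq).map ι)
  haveI : IsIso ι := isIso_of_isIsometricPreStep_of_isIso_toBirat_map (hF := hF) (hsq := hsq) ι hι
  rw [← hβι]
  exact hβ.comp hF ⟨isCoAngular_of_isIso F hF.isPreFrobenioid.isTotallyEpimorphic ι,
    isPreStep_of_isIso F ι⟩

/-- **Prop. 4.4 (iv)**, isomorphisms, both directions. [cite: MochizukiFrdI2008, Prop. 4.4 (iv) p.83] -/
theorem isIso_toBirat_map_iff {A B : C} (φ : A ⟶ B) :
    IsIso ((toBirat F hF hsq).map φ) ↔ IsCoAngularPreStep F φ :=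
  ⟨fun _ => isCoAngularPreStep_of_isIso_toBirat_map φ, fun h => isIso_toBirat_map φ h⟩

/-! ### co-angular in `C^birat` ⇒ co-angular in `C` -/

/-- **Prop. 4.4 (iv)**, co-angular morphisms, ONLY-IF direction (p. 85 l. 8–14): if `φ^birat` is
co-angular (for `C^birat → F_{0_D}`) then `φ` is co-angular. A factorisation `φ = γ ≫ β ≫ α` in `C` with
`β` an isometric pre-step maps to one in `C^birat` (every morphism of `C^birat` is isometric), so `β^birat`
is an isomorphism, so `β` is a co-angular pre-step, "hence an isomorphism whenever it is an isometry
[cf. Proposition 1.4, (iii)]". [cite: MochizukiFrdI2008, Prop. 4.4 (iv) p.85] -/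
theorem isCoAngular_of_isCoAngular_toBirat_map {A B : C} (φ : A ⟶ B)
    (h : (biratOps hF hsq).IsCoAngular ((toBirat F hF hsq).map φ)) : IsCoAngular F φ := by
  intro X Y γ β α hfac hα hβiso hβpre hbi
  have hfac' : (toBirat F hF hsq).map γ ≫ (toBirat F hF hsq).map β ≫ (toBirat F hF hsq).map α =
      (toBirat F hF hsq).map φ := by
    rw [← Functor.map_comp, ← Functor.map_comp, hfac]
  have hα' : (biratOps hF hsq).IsLinear ((toBirat F hF hsq).map α) := by
    change (biratOps hF hsq).degFr ((toBirat F hF hsq).map α) = 1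
    rw [biratOps_degFr_toBirat]; exact hα
  have hβ' : (biratOps hF hsq).IsIsometricPreStep ((toBirat F hF hsq).map β) := by
    refine ⟨⟨?_, ?_⟩, biratOps_mon_eq_one hF hsq _ _⟩
    · change (biratOps hF hsq).degFr ((toBirat F hF hsq).map β) = 1
      rw [biratOps_degFr_toBirat]; exact hβpre.1
    · change IsIso ((biratOps hF hsq).base.map ((toBirat F hF hsq).map β))
      rw [biratOps_base_map_toBirat]; exact hβpre.2
  have hbi' : (biratOps hF hsq).IsBaseIso ((toBirat F hF hsq).map α) ∨
      (biratOps hF hsq).IsBaseIso ((toBirat F hF hsq).map γ) := by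
    refine hbi.imp (fun h => ?_) (fun h => ?_)
    · change IsIso ((biratOps hF hsq).base.map ((toBirat F hF hsq).map α))
      rw [biratOps_base_map_toBirat]; exact h
    · change IsIso ((biratOps hF hsq).base.map ((toBirat F hF hsq).map γ))
      rw [biratOps_base_map_toBirat]; exact h
  haveI : IsIso ((toBirat F hF hsq).map β) := h _ _ _ hfac' hα' hβ' hbi'
  exact isIso_of_isCoAngularPreStep_of_isIsometry (isCoAngularPreStep_of_isIso_toBirat_map β) hβiso

/-- **Prop. 4.4 (iv)**, morphisms of Frobenius type, ONLY-IF direction: if `φ^birat` is of Frobenius type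
(co-angular, isometric, base-isomorphism in `C^birat`) then `φ` is a co-angular base-isomorphism of `C`.
[cite: MochizukiFrdI2008, Prop. 4.4 (iv) p.85] -/
theorem isCoAngular_isBaseIso_of_isFrobeniusType_toBirat_map {A B : C} (φ : A ⟶ B)
    (h : (biratOps hF hsq).IsFrobeniusType ((toBirat F hF hsq).map φ)) :
    IsCoAngular F φ ∧ IsBaseIso F φ := by
  refine ⟨isCoAngular_of_isCoAngular_toBirat_map φ h.1.1, ?_⟩
  have h2 : IsIso ((biratOps hF hsq).base.map ((toBirat F hF hsq).map φ)) := h.2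
  rwa [biratOps_base_map_toBirat] at h2

/-! ### isotropic in `C^birat` ⇒ isotropic in `C` -/

/-- **Prop. 4.4 (iv)**, isotropic objects, ONLY-IF direction (p. 85 l. 29–31): if `A^birat` is isotropic
then `A` is isotropic — an isometric pre-step `ι : A → Z` maps to a pre-step (hence, `C^birat` being of
group-like type, an isometric pre-step) out of `A^birat`, thus to an isomorphism, so `ι` is a
co-angular isometric pre-step, i.e. an isomorphism (Prop. 1.4 (iii)). [cite: MochizukiFrdI2008, Prop. 4.4 (iv) p.85] -/
theorem isIsotropic_of_isIsotropic_toBirat_obj {A : C}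
    (h : (biratOps hF hsq).IsIsotropic ((toBirat F hF hsq).obj A)) : IsIsotropic F A := by
  intro Z ι hiso hpre
  have hι' : (biratOps hF hsq).IsIsometricPreStep ((toBirat F hF hsq).map ι) := by
    refine ⟨⟨?_, ?_⟩, biratOps_mon_eq_one hF hsq _ _⟩
    · change (biratOps hF hsq).degFr ((toBirat F hF hsq).map ι) = 1
      rw [biratOps_degFr_toBirat]; exact hpre.1
    · change IsIso ((biratOps hF hsq).base.map ((toBirat F hF hsq).map ι))
      rw [biratOps_base_map_toBirat]; exact hpre.2
  haveI : IsIso ((toBirat F hF hsq).map ι) := h ((toBirat F hF hsq).map ι) hι'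
  exact isIso_of_isCoAngularPreStep_of_isIsometry (isCoAngularPreStep_of_isIso_toBirat_map ι) hiso


/-! ### pull-back in `C^birat` ⇒ co-angular (linear) in `C` -/

/-- In any category over a base, if `q` and `p ≫ q` are pull-back morphisms (Def. 1.2 (ii)) and `Base p`
is an isomorphism, then `p` is an isomorphism ("[by the isomorphism of functors appearing in the
definition of a 'pull-back morphism'] this implies formally that `α^birat` is an isomorphism", FrdI
p. 85 l. 27–28). [cite: MochizukiFrdI2008, Prop. 4.4 (iv) p.85] -/
theorem _root_.Literature.AlgebraicGeometry.Frobenioids.PreFrobenioidData.isIso_of_isPullbackMorphism_comp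
    {C₀ : Type u'} [Category.{v'} C₀] {D₀ : Type u} [Category.{v} D₀] (S : PreFrobenioidData.{w} C₀ D₀)
    {X Y Z : C₀} (p : X ⟶ Y) (q : Y ⟶ Z) (hq : S.IsPullbackMorphism q)
    (hpq : S.IsPullbackMorphism (p ≫ q)) (hp : S.IsBaseIso p) : IsIso p := by
  haveI : IsIso (S.base.map p) := hp
  obtain ⟨r, ⟨hr₁, hr₂⟩, -⟩ := hpq q (inv (S.base.map p))
    (by rw [S.base.map_comp, IsIso.inv_hom_id_assoc])
  have h₁ : p ≫ r = 𝟙 X := by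
    obtain ⟨ψ, -, huniq⟩ := hpq (p ≫ q) (𝟙 _) (by rw [Category.id_comp])
    have e₁ : p ≫ r = ψ := huniq (p ≫ r)
      ⟨by rw [Category.assoc, hr₁], by rw [S.base.map_comp, hr₂, IsIso.hom_inv_id]⟩
    have e₂ : 𝟙 X = ψ := huniq (𝟙 X) ⟨by rw [Category.id_comp], S.base.map_id X⟩
    rw [e₁, ← e₂]
  have h₂ : r ≫ p = 𝟙 Y := by
    obtain ⟨ψ, -, huniq⟩ := hq q (𝟙 _) (by rw [Category.id_comp])
    have e₁ : r ≫ p = ψ := huniq (r ≫ p)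
      ⟨by rw [Category.assoc, hr₁], by rw [S.base.map_comp, hr₂, IsIso.inv_hom_id]⟩
    have e₂ : 𝟙 Y = ψ := huniq (𝟙 Y) ⟨by rw [Category.id_comp], S.base.map_id Y⟩
    rw [e₁, ← e₂]
  exact ⟨r, h₁, h₂⟩

/-- **Prop. 1.7 (iii)** (the case needed here): a LINEAR morphism of a Frobenioid factors as
`(pre-step) ≫ (pull-back morphism)` — in the factorisation of Def. 1.3 (iv)(a) the Frobenius-type
factor is linear, hence a co-angular isometric pre-step, hence an isomorphism (Prop. 1.4 (iii)).
[cite: MochizukiFrdI2008, Prop. 1.7 (iii) p.28] -/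
theorem exists_preStep_comp_pullback_of_isLinear (hF : IsFrobenioid F) {A B : C} (φ : A ⟶ B)
    (hlin : IsLinear F φ) :
    ∃ (Y : C) (p : A ⟶ Y) (α : Y ⟶ B), p ≫ α = φ ∧ IsPreStep F p ∧ IsPullbackMorphism F α := by
  obtain ⟨X, Y, γ, β, α, hfac, hγ, hβ, hα⟩ := hF.iv_a_exists φ
  have hγc : IsCoAngularPreStep F γ := isCoAngularPreStep_of_factorisation hF hlin hfac hγ hβ hα
  haveI : IsIso γ := isIso_of_isCoAngularPreStep_of_isIsometry hγc hγ.1.2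
  refine ⟨Y, γ ≫ β, α, by rw [Category.assoc, hfac], ?_, hα⟩
  exact IsPreStep.comp F (isPreStep_of_isIso F γ) hβ

/-- **Prop. 4.4 (iv)**, pull-back morphisms: "if `φ : A → B` is a morphism of `C` that maps to a pull-back
morphism `φ^birat` of `C^birat`, then it follows that `φ` is linear" (p. 85 l. 22–23). Print invokes the
Frobenioid structure of `C^birat`; here directly: with `φ = γ ≫ β ≫ α` as in Def. 1.3 (iv)(a), the
pull-back property of `φ^birat` applied to `(β ≫ α)^birat` and `Base(γ)⁻¹` yields `ψ` with
`ψ ≫ φ^birat = (β ≫ α)^birat`, and Frobenius degrees multiply: `deg ψ · deg φ = deg β · deg α = 1`.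
[cite: MochizukiFrdI2008, Prop. 4.4 (iv) p.85] -/
theorem isLinear_of_isPullbackMorphism_toBirat_map {A B : C} (φ : A ⟶ B)
    (h : (biratOps hF hsq).IsPullbackMorphism ((toBirat F hF hsq).map φ)) : IsLinear F φ := by
  obtain ⟨X, Y, γ, β, α, hfac, hγ, hβ, hα⟩ := hF.iv_a_exists φ
  haveI : IsIso (Base F γ) := hγ.2
  have e1 : (biratOps hF hsq).base.map ((toBirat F hF hsq).map φ) = Base F φ :=
    biratOps_base_map_toBirat φ
  have e2 : (biratOps hF hsq).base.map ((toBirat F hF hsq).map (β ≫ α)) = Base F (β ≫ α) :=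
    biratOps_base_map_toBirat _
  have e3 : inv (Base F γ) ≫ Base F φ = Base F (β ≫ α) :=
    (IsIso.inv_comp_eq (Base F γ)).mpr ((congrArg (Base F) hfac).symm.trans (base_comp F γ (β ≫ α)))
  have hcond : inv (Base F γ) ≫ (biratOps hF hsq).base.map ((toBirat F hF hsq).map φ) =
      (biratOps hF hsq).base.map ((toBirat F hF hsq).map (β ≫ α)) :=
    (congrArg (inv (Base F γ) ≫ ·) e1).trans (e3.trans e2.symm)
  obtain ⟨ψ, ⟨hψ, -⟩, -⟩ := h _ _ hcond
  have hdeg := congrArg (biratOps hF hsq).degFr hψ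
  have hR : (biratOps hF hsq).degFr ((toBirat F hF hsq).map (β ≫ α)) = 1 :=
    (biratOps_degFr_toBirat (hF := hF) (hsq := hsq) (β ≫ α)).trans
      (by rw [degFr_comp, hβ.1, (hF.iv_b α hα).2, mul_one])
  have hL : (biratOps hF hsq).degFr (ψ ≫ (toBirat F hF hsq).map φ) =
      (biratOps hF hsq).degFr ψ * degFr F φ :=
    ((biratOps hF hsq).degFr_comp ψ _).trans
      (congrArg ((biratOps hF hsq).degFr ψ * ·) (biratOps_degFr_toBirat φ))
  have key : (biratOps hF hsq).degFr ψ * degFr F φ = 1 := hL.symm.trans (hdeg.trans hR)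
  have key' : ((biratOps hF hsq).degFr ψ : ℕ) * (degFr F φ : ℕ) = 1 := by exact_mod_cast key
  exact PNat.coe_inj.mp (Nat.eq_one_of_mul_eq_one_left key')

/-- **Prop. 4.4 (iv)**, pull-back morphisms, ONLY-IF direction (p. 85 l. 22–29): if `φ^birat` is a
pull-back morphism of `C^birat` then `φ` is a co-angular linear morphism of `C`. `φ` is linear
(`isLinear_of_isPullbackMorphism_toBirat_map`), so `φ = p ≫ α` with `p` a pre-step and `α` a pull-back
morphism (Prop. 1.7 (iii)); then `φ^birat = p^birat ≫ α^birat` with `φ^birat`, `α^birat` pull-back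
morphisms and `p^birat` a base-isomorphism, so `p^birat` is an isomorphism, so `p` is a co-angular
pre-step; `α` is co-angular (Def. 1.3 (iv)(b)), hence so is `φ` (Def. 1.3 (iii)(a)).
[cite: MochizukiFrdI2008, Prop. 4.4 (iv) p.85] -/
theorem isCoAngular_isLinear_of_isPullbackMorphism_toBirat_map {A B : C} (φ : A ⟶ B)
    (h : (biratOps hF hsq).IsPullbackMorphism ((toBirat F hF hsq).map φ)) :
    IsCoAngular F φ ∧ IsLinear F φ := by
  have hlin : IsLinear F φ := isLinear_of_isPullbackMorphism_toBirat_map φ h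
  refine ⟨?_, hlin⟩
  obtain ⟨Y, p, α, hfac, hp, hα⟩ := exists_preStep_comp_pullback_of_isLinear hF φ hlin
  subst hfac
  have hαb : (biratOps hF hsq).IsPullbackMorphism ((toBirat F hF hsq).map α) :=
    (PreFrobenioidData.ofFunctor_isPullbackMorphism (Birat.toElemZero hF hsq) _).mpr
      (isPullbackMorphism_toBirat_map (hF := hF) (hsq := hsq) hα)
  have hpq : (biratOps hF hsq).IsPullbackMorphism
      ((toBirat F hF hsq).map p ≫ (toBirat F hF hsq).map α) := by
    rw [← Functor.map_comp]; exact h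
  have hpb : (biratOps hF hsq).IsBaseIso ((toBirat F hF hsq).map p) := by
    change IsIso ((biratOps hF hsq).base.map ((toBirat F hF hsq).map p))
    rw [biratOps_base_map_toBirat]; exact hp.2
  haveI : IsIso ((toBirat F hF hsq).map p) :=
    PreFrobenioidData.isIso_of_isPullbackMorphism_comp (biratOps hF hsq) _ _ hαb hpq hpb
  exact hF.iii_a p α (isCoAngularPreStep_of_isIso_toBirat_map p).1 (hF.iv_b α hα).1.1

/-- **Prop. 4.4 (iv)**, pull-back morphisms, both directions: `φ^birat` is a pull-back morphism of
`C^birat` iff `φ` is a co-angular linear morphism of `C` (image direction: abc-iut-L6-t8's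
`isPullbackMorphism_toBirat_map_of_isCoAngular`). [cite: MochizukiFrdI2008, Prop. 4.4 (iv) p.83] -/
theorem isPullbackMorphism_toBirat_map_iff {A B : C} (φ : A ⟶ B) :
    (biratOps hF hsq).IsPullbackMorphism ((toBirat F hF hsq).map φ) ↔ IsCoAngular F φ ∧ IsLinear F φ :=
  ⟨isCoAngular_isLinear_of_isPullbackMorphism_toBirat_map φ, fun hφ =>
    (PreFrobenioidData.ofFunctor_isPullbackMorphism (Birat.toElemZero hF hsq) _).mpr
      (isPullbackMorphism_toBirat_map_of_isCoAngular (hF := hF) (hsq := hsq) hφ.1 hφ.2)⟩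

end Birat

end PreFrobenioid

end Literature.AlgebraicGeometry.Frobenioids
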